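import Summits.QuantumFields.YangMills.Theorems.BalabanUVNodesN20KeyedRelWeightLevels
import Summits.QuantumFields.YangMills.Theorems.BalabanUVNodesSpineReadingOfRecord13CoPHK

/-!
# BalabanUVNodes ∕ N20 (NE7b) — THE N20 FACE AT dag-n20-d's KEY-READING EDITION `crOfRecord₁₃KAt K₀ kr bd sh`: CANONICAL FORM AT ANY DIAL; THE BIRTH-LEVEL SOCKETS AT A
# STEP-PRESERVING DIAL; and (LOCATED) AT THE LEVEL-WINDOW DIAL THE FIRST LEVEL IS NOT UNBOOKED — the policy wall of the full key («every weight-carrying cut is eventually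
# zero», dag-n20-w1 p597932) MOVES to «cut ≤ floor, eventually», where the coarse persistence class is EMPTY: the weight face is idle at the level window too

Cell `pub-ymgap` (HUMAN RULING D-0062 Track A; work-bound push D-0149, director-ym №197), width seat `pub-ymgap-dag-n20-w2` (gen 3) on node N20 = NE7b; CLAIM-3 of the re-seat
(this lineage's object — the persistence class ∕ canonical fraction ∕ birth levels of the N20 face — read at dag-n20-d's key-reading edition `Thm/BalabanUVNodesSpineReadingOfRecord13CoPHK`,
p608328, «the OBJECT a key-reading dial pins to», typed for the crux card `Cruxes/SpineGivenEndpointR13SepCoPH/Ideas/window-key-core.md`).  Filed `--kind proof --supports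
stmt-QuantumFields-20544 --as helper` (K3⁷ `SpineGivenEndpointR13SepCoPH`; skeleton v5 941dddb108cbaacf STANDS — no v6 text is assumed: every theorem below is about the reading
`crOfRecord₁₃KAt`, whose identity-dial instance IS v5's pin, `crOfRecord₁₃KAt_id`); COUNT-NEUTRAL; LOCATED.
[III] = [Balaban1988Convergent], [LF-I] = [Balaban1989LargeFieldI], [LF-II] = [Balaban1989LargeFieldII].

WHY.  The crux card reads N19′ ∧ N20 at a COARSER key than the full (2.18) history and n20-d typed the reading with a key-reading dial `kr` and a bad-key reading `bd`
(`crOfRecord₁₃KAt`), with the LEVEL WINDOW `windowKeyReading₁₃ K₀ c` (`Node00/TwoRunSiteWindow`: forget the entries at the levels `1 ≤ j ≤ c K`, KEEP the later ones as they are)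
as the dial's first value and «a level cut at or below the floor books nothing» (`bad_window_eq_empty_of_cut_le_floor`).  Two things the N20 face needs there are this lineage's:
(a) its CANONICAL FORM at the dial — `RelWeightBound` at `crOfRecord₁₃KAt` ⟺ `(∀ K, W K < 1) ∧ Summable W` for the reading's own `W ∈ [0,1]`, at ANY `kr`, ANY `bd`, hypothesis-free
at a tuple with core provisos (gen 2's `…Canonical` §1 generics over n20-d's coarse carriers) — and the birth-level sockets of CLAIM-1 at a step-preserving dial; (b) the LOCATED
answer to «does the level window give the weight face content?»: NO.  The (2.1) chain of an admissible index is CUMULATIVE — `Ω_1 ⊇ Λ_1 ⊇ Ω_2 ⊇ Λ_2 ⊇ …` ([III] p.254; gen 0's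
`seq_exists_Λ_ne_univ_iff_last`: «the large-field regions `Z_j = Λ_jᶜ` only grow; once born they persist») — so a history with a level-1 large field has `Λ_j ≠ T_η` at EVERY
kept level `j > c K`, its window key is BAD under every cut above the floor, and the census's first-level saturation (dag-n20-w1 `…PolicyWall` p597932 §2, displayed letter)
reaches the weight face exactly as at the full key: any `RelWeightBound` at the window reading forces `jcut K ≤ c K` cofinitely (§4), where the coarse bad class is EMPTY.
The level window moves the wall from «cut `= 0`» to «cut `≤` floor»; the weight face books NOTHING cofinitely either way.  What COULD carry NE7b's weight content is a
REGION-relative (pending-status) coarsening — the card's `wkey`, [LF-II] (1.80) — which n20-d's header says the level window is NOT (that quotient is untyped; not claimed here).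
CONTENTS (theorems only; 0 `def`):
* §1 (ANY dial `kr`, ANY bad reading `bd`; every Stage-13 tuple with core provisos) `weightAK₁₃_nonneg_of_provisos` ∕ `weightBK₁₃_nonneg_of_provisos` · `one_mem_admW_carriersK₁₃` ·
  `W_crOfRecord₁₃KAt_le_one` · `badMass_le_W_crOfRecord₁₃KAt_left ∕ _right` · ★★ `relWeightBound_crOfRecord₁₃KAt_iff`;
* §2 (a STEP-PRESERVING dial `(kr K x).1 = K` on the class set, n20-d's level-cut bad reading `fun _ x ↦ KeyOldLargeField (jcut x.1) x.2` = `badKeyReadingOfCut₁₃ … jcut` at the tuple)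
  `fst_eq_of_mem_classSetK₁₃` · `mem_badClassK₁₃_cut_iff` · `badClassK₁₃_cut_congr_at ∕ _mono_at ∕ _zero_at` · ★★ `sum_badClassK₁₃_cut_eq_sum_strata`
  (the birth-level stratification of the COARSE persistence class, exact; CLAIM-1 §1 `sum_eq_sum_range_strata`);
* §3 ★★ `W_crOfRecord₁₃KAt_le_sum_levels` · ★★ `relWeightBound_crOfRecord₁₃KAt_of_levelFractions` (per-stratum fractions at the coarse carriers ⇒ the face AT the dial reading);
* §4 THE LEVEL-WINDOW DIAL (`kr := fun _ x ↦ windowKeySigma F c x` = `windowKeyReading₁₃ K₀ c` at the tuple; `0 < θ.τ9.M`; floor inside the run `c K < K₀ + K`):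
  `windowKeySigma_fst_eq` · `badClassK₁₃_window_cut_eq_empty_at` (cut `≤` floor AT `K` ⇒ `∅`) · ★ `keyOldLargeField_iff_last_of_mem_classSet₁₃` (for a CLASS key of record
  `KeyOldLargeField n x.2 ⟺ x.2.2 n ≠ T_η`, `1 ≤ n ≤ K₀+K` — the cumulative chain at the key, both runs) · ★ `windowKeySigma_mem_badClassK₁₃_of_levelOne` (a class key with a
  level-1 large field reads to a BAD window key under every cut above the floor) · `levelOne_mass_le_badMass_window_left ∕ _right` · ★★ `le_W_crOfRecord₁₃KAt_window_of_levelOne_fraction`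
  (`c ≤ W K` at a step cutting above the floor where the level-one class holds the fraction `c` of run A's mass) · ★★ `eventually_cut_le_floor_of_relWeightBound_window` (THE WALL AT
  THE LEVEL WINDOW) · ★★ `eventually_badClassK₁₃_window_eq_empty_of_relWeightBound` (⇒ the weight face books NOTHING cofinitely).
Cited BY NAME, not re-typed: n20-d `…SpineReadingOfRecord13CoPHK` + `Node00/TwoRunSiteWindow`; `…SpineCanonicalWeights`; gen 2 `…Canonical` §1 generics; gen 0
`…N21KeyedShellWeightShellZero` ∕ `…N20TwoRunKeyedPersistentWeight` (`…_iff_last`, `blockDownSet_seq_Λ_succ_eq_univ_iff`); dag-n20-w1 `…SocketAtRecord13CoPH` ∕ `…OverCut` ∕ `…PolicyWall`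
(the wall's pattern `T4BadClassBooking.le_weight_of_fraction_le` + `T4ShellCount.not_summable_of_frequently_le`); CLAIM-1 `…Levels` §1.

HONEST FRAMING.  [folklore] finite-sum ∕ real-analysis bookkeeping BY NAME over n20-d's readings; the saturation letter of §4 is DISPLAYED (the census's count, dag-n20-w3 ∕ dag-n20-w1; not
proved here); §3's per-stratum fractions are HYPOTHESES (NE7b's body, NAMED OPEN); NO weight bounded, NO estimate proved.  §4 is a statement about WHICH KEY could carry NE7b, not about
Bałaban: nothing of Bałaban's is asserted; NE7 ∕ NE7b ∕ NE7c NOT PRINTED for `d = 4`, NOT proved; (α)-instance 0∕1; no `Provisos₁₃CoPH` inhabitant claimed (K0⁷ OPEN); N19 ∕ N20 ∕ N21 ∕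
N27 NOT discharged; K3⁷ NOT closed (v5 stands; the dial edition is n20-d's offer object, no re-pin assumed); counts unmoved (typed 28∕28 · discharged 5∕27); no count claim (the chair's
single count line is the only count).  One finite `𝕋⁴_{L^K}` programme at fixed `ε = L^{−K}`, Bałaban AS PRINTED; the YM mass gap (Clay) is NOT proved by any of this — R4 closes the
conditional finite-𝕋⁴ rung `BalabanLadder.UV` only; NOT ℝ⁴ ∕ infinite volume ∕ OS.  No `def` ∕ `instance` ∕ `notation` ∕ `sorry`.  Sources (locators only): [III] (2.1) p.254,
(2.18) p.257; [LF-II] (1.80) p.384, Thm 1 pp.355–356; [King1986] (3.10)–(3.11) p.656. -/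

noncomputable section

open scoped BigOperators
open _root_.Filter _root_.Topology
namespace Summit.QuantumFields.YangMills.BalabanUVNodes.N20KeyedRelWeightAtKeyReading

open Literature.MathematicalPhysics.QuantumFieldTheory.Balaban1983to89 Literature.MathematicalPhysics.QuantumFieldTheory.Balaban1983to89.Node00
open T4Continuum
open T4WeightBudget (RelWeightBound)
open T4BadClassBooking (le_weight_of_fraction_le)
open T4ShellCount (not_summable_of_frequently_le)
open YMDAG.UVSplit hiding SU
open Summit.QuantumFields.YangMills.BalabanUVNodes.SpineCanonicalWeights
open Summit.QuantumFields.YangMills.BalabanUVNodes.N21KeyedShellWeightShellZero (weightA₁₃_nonneg weightB₁₃_nonneg)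
open Summit.QuantumFields.YangMills.BalabanUVNodes.N20KeyedRelWeightCanonical (one_mem_admW bad_left_wInf bad_right_wInf relWeightBound_wInf_iff_lt_one_summable)
open Summit.QuantumFields.YangMills.BalabanUVNodes.N20KeyedRelWeightSocketAtRecord13CoPH (keyA₁₃_mem_classSet₁₃ keyB₁₃_mem_classSet₁₃)
open Summit.QuantumFields.YangMills.BalabanUVNodes.N20KeyedRelWeightOverCut (fst_eq_of_mem_classSet₁₃)
open Summit.QuantumFields.YangMills.BalabanUVNodes.N20TwoRunKeyedPersistentWeight (keyOldLargeField_twoRunKeyA_iff_last keyOldLargeField_twoRunKeyB_iff_last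
  blockDownSet_seq_Λ_succ_eq_univ_iff)
open Summit.QuantumFields.YangMills.BalabanUVNodes.N20KeyedRelWeightLevels (sum_eq_sum_range_strata)

variable {F : T4Family} {N : ℕ} [NeZero N]

/-! ## §1  The N20 face at the key-reading edition, ANY dial, ANY bad reading: canonical form -/

section Canonical

variable (θ : Stage13HParams F N) (hP : θ.Provisos₁₃CoPH F N) (K₀ : ℕ) (g₀ : ℕ → ℝ) (os : List (ULoop F))
  (kr : ℕ → (Σ K, SiteSeqKey F (K₀ + K)) → (Σ K, SiteSeqKey F (K₀ + K))) (bd : ℕ → (Σ K, SiteSeqKey F (K₀ + K)) → Prop)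

/-- **THE COARSE CLASS WEIGHTS ARE `≥ 0` AT A TUPLE WITH CORE PROVISOS, run A** (n20-d's `weightAK₁₃_nonneg` fed with gen 0's `weightA₁₃_nonneg`; every key, every dial).
[cite: Balaban1988Convergent, (2.18) p.257 (bookkeeping)] -/
theorem weightAK₁₃_nonneg_of_provisos (K : ℕ) (t : ℝ) (u : Σ K, SiteSeqKey F (K₀ + K)) : 0 ≤ weightAK₁₃ θ hP K₀ g₀ os kr K t u :=
  weightAK₁₃_nonneg θ hP K₀ g₀ os kr (fun x _ => weightA₁₃_nonneg F θ hP K₀ g₀ os K t x) u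

/-- **… run B.** [cite: Balaban1988Convergent, (2.18) p.257 (bookkeeping)] -/
theorem weightBK₁₃_nonneg_of_provisos (K : ℕ) (t : ℝ) (u : Σ K, SiteSeqKey F (K₀ + K)) : 0 ≤ weightBK₁₃ θ hP K₀ g₀ os kr K t u :=
  weightBK₁₃_nonneg θ hP K₀ g₀ os kr (fun x _ => weightB₁₃_nonneg F θ hP K₀ g₀ os K t x) u

/-- **AT THE COARSE CARRIERS THE WEIGHT `1` IS ADMISSIBLE AT EVERY STEP** (coarse weights `≥ 0`, the coarse bad class consists of coarse classes). [cite: King1986, (3.10)–(3.11) p.656 (bookkeeping)] -/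
theorem one_mem_admW_carriersK₁₃ (K : ℕ) :
    (1 : ℝ) ∈ admW 1 (classSetK₁₃ θ K₀ g₀ kr) (weightAK₁₃ θ hP K₀ g₀ os kr) (weightBK₁₃ θ hP K₀ g₀ os kr) (badClassK₁₃ θ K₀ g₀ kr bd) K :=
  one_mem_admW (fun K t _ u _ => weightAK₁₃_nonneg_of_provisos θ hP K₀ g₀ os kr K t u) (fun K t _ u _ => weightBK₁₃_nonneg_of_provisos θ hP K₀ g₀ os kr K t u)
    (fun K t _ => badClassK₁₃_subset θ K₀ g₀ kr bd K t) K

variable (krR : KeyReading₁₃ N K₀) (bdR : BadKeyReading₁₃ N K₀) (sh : ShellSplit₁₃CoPH N K₀)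

/-- **THE DIAL READING's `W` IS `≤ 1`** at every step, every tuple with core provisos, every dial. [cite: Balaban1989LargeFieldII, (1.80) p.384; King1986, (3.10)–(3.11) p.656 (bookkeeping)] -/
theorem W_crOfRecord₁₃KAt_le_one (K : ℕ) : (crOfRecord₁₃KAt K₀ krR bdR sh F θ hP g₀ os).W K ≤ 1 :=
  wInf_le_of_mem (one_mem_admW_carriersK₁₃ θ hP K₀ g₀ os (krR F θ hP g₀ os) (bdR F θ hP g₀ os) K)

/-- **THE DIAL READING's `W` IS A RELATIVE WEIGHT OF ITS COARSE PERSISTENCE CLASS, run A** (hypothesis-free at a tuple with core provisos).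
[cite: Balaban1989LargeFieldII, (1.80) p.384; King1986, (3.10)–(3.11) p.656 (bookkeeping)] -/
theorem badMass_le_W_crOfRecord₁₃KAt_left (K : ℕ) {t : ℝ} (ht : |t| ≤ 1) :
    ∑ u ∈ (crOfRecord₁₃KAt K₀ krR bdR sh F θ hP g₀ os).Bad K t, (crOfRecord₁₃KAt K₀ krR bdR sh F θ hP g₀ os).A K t u ≤
      (crOfRecord₁₃KAt K₀ krR bdR sh F θ hP g₀ os).W K * ∑ u ∈ (crOfRecord₁₃KAt K₀ krR bdR sh F θ hP g₀ os).T K, (crOfRecord₁₃KAt K₀ krR bdR sh F θ hP g₀ os).A K t u :=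
  bad_left_wInf (fun K t _ u _ => weightAK₁₃_nonneg_of_provisos θ hP K₀ g₀ os (krR F θ hP g₀ os) K t u)
    (fun K t _ u _ => weightBK₁₃_nonneg_of_provisos θ hP K₀ g₀ os (krR F θ hP g₀ os) K t u)
    (fun K t _ => badClassK₁₃_subset θ K₀ g₀ (krR F θ hP g₀ os) (bdR F θ hP g₀ os) K t) K ht

/-- **… run B.** [cite: Balaban1989LargeFieldII, (1.80) p.384; King1986, (3.10)–(3.11) p.656 (bookkeeping)] -/
theorem badMass_le_W_crOfRecord₁₃KAt_right (K : ℕ) {t : ℝ} (ht : |t| ≤ 1) :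
    ∑ u ∈ (crOfRecord₁₃KAt K₀ krR bdR sh F θ hP g₀ os).Bad K t, (crOfRecord₁₃KAt K₀ krR bdR sh F θ hP g₀ os).B K t u ≤
      (crOfRecord₁₃KAt K₀ krR bdR sh F θ hP g₀ os).W K * ∑ u ∈ (crOfRecord₁₃KAt K₀ krR bdR sh F θ hP g₀ os).T K, (crOfRecord₁₃KAt K₀ krR bdR sh F θ hP g₀ os).B K t u :=
  bad_right_wInf (fun K t _ u _ => weightAK₁₃_nonneg_of_provisos θ hP K₀ g₀ os (krR F θ hP g₀ os) K t u)
    (fun K t _ u _ => weightBK₁₃_nonneg_of_provisos θ hP K₀ g₀ os (krR F θ hP g₀ os) K t u)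
    (fun K t _ => badClassK₁₃_subset θ K₀ g₀ (krR F θ hP g₀ os) (bdR F θ hP g₀ os) K t) K ht

/-- **★★ THE N20 FACE AT THE KEY-READING EDITION IS TWO NUMERIC CONDITIONS ON ITS OWN `W`, AT ANY DIAL AND ANY BAD READING** — every Stage-13 tuple with core provisos, every
`K₀ g₀ os sh`, HYPOTHESIS-FREE: `RelWeightBound (cr…).l₀ (cr…).T (cr…).A (cr…).B (cr…).Bad (cr…).W ⟺ (∀ K, (cr…).W K < 1) ∧ Summable (cr…).W` for
`cr… := crOfRecord₁₃KAt K₀ kr bd sh F θ hP g₀ os` (gen 2's `relWeightBound_wInf_iff_lt_one_summable` at n20-d's coarse carriers; the identity-dial instance is gen 2's V-reading iff).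
[cite: Balaban1989LargeFieldII, Thm 1 + (0.1) pp.355–356, (1.80) p.384; King1986, (3.10)–(3.11) p.656 (bookkeeping)] -/
theorem relWeightBound_crOfRecord₁₃KAt_iff :
    RelWeightBound (crOfRecord₁₃KAt K₀ krR bdR sh F θ hP g₀ os).l₀ (crOfRecord₁₃KAt K₀ krR bdR sh F θ hP g₀ os).T (crOfRecord₁₃KAt K₀ krR bdR sh F θ hP g₀ os).A
        (crOfRecord₁₃KAt K₀ krR bdR sh F θ hP g₀ os).B (crOfRecord₁₃KAt K₀ krR bdR sh F θ hP g₀ os).Bad (crOfRecord₁₃KAt K₀ krR bdR sh F θ hP g₀ os).W ↔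
      (∀ K, (crOfRecord₁₃KAt K₀ krR bdR sh F θ hP g₀ os).W K < 1) ∧ Summable (crOfRecord₁₃KAt K₀ krR bdR sh F θ hP g₀ os).W :=
  relWeightBound_wInf_iff_lt_one_summable (fun K t _ u _ => weightAK₁₃_nonneg_of_provisos θ hP K₀ g₀ os (krR F θ hP g₀ os) K t u)
    (fun K t _ u _ => weightBK₁₃_nonneg_of_provisos θ hP K₀ g₀ os (krR F θ hP g₀ os) K t u)
    fun K t _ => badClassK₁₃_subset θ K₀ g₀ (krR F θ hP g₀ os) (bdR F θ hP g₀ os) K t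

end Canonical
/-! ## §2  A step-preserving dial under the level-cut bad reading: the level chain of the COARSE persistence class and its strata -/

section Levels

variable (θ : Stage13HParams F N) (K₀ : ℕ) (g₀ : ℕ → ℝ) (kr : ℕ → (Σ K, SiteSeqKey F (K₀ + K)) → (Σ K, SiteSeqKey F (K₀ + K)))

/-- **AT A STEP-PRESERVING DIAL A COARSE CLASS KEY AT STEP `K` HAS STEP COMPONENT `K`** (`(kr K x).1 = K` on the class set; the identity and the level window qualify).
[cite: Balaban1988Convergent, (2.18) p.257 (bookkeeping)] -/
theorem fst_eq_of_mem_classSetK₁₃ (hkr : ∀ (K : ℕ) (x : Σ K, SiteSeqKey F (K₀ + K)), x ∈ classSet₁₃ θ K₀ g₀ K → (kr K x).1 = K) (K : ℕ)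
    {u : Σ K, SiteSeqKey F (K₀ + K)} (hu : u ∈ classSetK₁₃ θ K₀ g₀ kr K) : u.1 = K := by
  letI : ∀ Kc, DecidableEq (SiteSeqKey F Kc) := fun _ => Classical.decEq _
  unfold classSetK₁₃ at hu
  obtain ⟨x, hx, rfl⟩ := Finset.mem_image.1 hu
  exact hkr K x hx

variable (hkr : ∀ (K : ℕ) (x : Σ K, SiteSeqKey F (K₀ + K)), x ∈ classSet₁₃ θ K₀ g₀ K → (kr K x).1 = K)
include hkr

/-- **MEMBERSHIP IN THE COARSE PERSISTENCE CLASS READS THE POLICY AT `K` ONLY** (step-preserving dial): `u ∈ badClassK₁₃ … kr (cut jcut) K t ↔ u ∈ classSetK₁₃ … kr K ∧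
KeyOldLargeField (jcut K) u.2`. [cite: Balaban1989LargeFieldII, (1.80) p.384 (bookkeeping)] -/
theorem mem_badClassK₁₃_cut_iff (jcut : ℕ → ℕ) (K : ℕ) (t : ℝ) (u : Σ K, SiteSeqKey F (K₀ + K)) :
    u ∈ badClassK₁₃ θ K₀ g₀ kr (fun _ x => KeyOldLargeField (jcut x.1) x.2) K t ↔ u ∈ classSetK₁₃ θ K₀ g₀ kr K ∧ KeyOldLargeField (jcut K) u.2 := by
  rw [mem_badClassK₁₃_iff]
  constructor
  · rintro ⟨hu, h⟩
    exact ⟨hu, fst_eq_of_mem_classSetK₁₃ θ K₀ g₀ kr hkr K hu ▸ h⟩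
  · rintro ⟨hu, h⟩
    exact ⟨hu, (fst_eq_of_mem_classSetK₁₃ θ K₀ g₀ kr hkr K hu).symm ▸ h⟩

/-- **AT-ONE-STEP MONOTONICITY** of the coarse persistence class in the cut. [cite: Balaban1989LargeFieldII, (1.80) p.384 (bookkeeping)] -/
theorem badClassK₁₃_cut_mono_at {jcut jcut' : ℕ → ℕ} {K : ℕ} (h : jcut K ≤ jcut' K) (t : ℝ) :
    badClassK₁₃ θ K₀ g₀ kr (fun _ x => KeyOldLargeField (jcut x.1) x.2) K t ⊆ badClassK₁₃ θ K₀ g₀ kr (fun _ x => KeyOldLargeField (jcut' x.1) x.2) K t := by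
  intro u hu
  rw [mem_badClassK₁₃_cut_iff θ K₀ g₀ kr hkr] at hu ⊢
  exact ⟨hu.1, hu.2.mono h⟩

/-- Two policies agreeing at `K` have the same coarse persistence class at step `K`. [cite: Balaban1989LargeFieldII, (1.80) p.384 (bookkeeping)] -/
theorem badClassK₁₃_cut_congr_at {jcut jcut' : ℕ → ℕ} {K : ℕ} (h : jcut K = jcut' K) (t : ℝ) :
    badClassK₁₃ θ K₀ g₀ kr (fun _ x => KeyOldLargeField (jcut x.1) x.2) K t = badClassK₁₃ θ K₀ g₀ kr (fun _ x => KeyOldLargeField (jcut' x.1) x.2) K t :=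
  Finset.Subset.antisymm (badClassK₁₃_cut_mono_at θ K₀ g₀ kr hkr h.le t) (badClassK₁₃_cut_mono_at θ K₀ g₀ kr hkr h.ge t)

/-- **A POLICY VANISHING AT `K` BOOKS NOTHING AT STEP `K`** (nothing is old below level `0`). [cite: Balaban1989LargeFieldII, (1.80) p.384 (bookkeeping)] -/
theorem badClassK₁₃_cut_zero_at {jcut : ℕ → ℕ} {K : ℕ} (h : jcut K = 0) (t : ℝ) :
    badClassK₁₃ θ K₀ g₀ kr (fun _ x => KeyOldLargeField (jcut x.1) x.2) K t = ∅ := by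
  refine Finset.eq_empty_of_forall_notMem fun u hu => ?_
  rw [mem_badClassK₁₃_cut_iff θ K₀ g₀ kr hkr, h] at hu
  exact not_keyOldLargeField_zero _ hu.2

variable [DecidableEq (Σ K, SiteSeqKey F (K₀ + K))]

/-- **★★ THE BIRTH-LEVEL STRATIFICATION OF THE COARSE PERSISTENCE CLASS** (step-preserving dial, level-cut bad reading, any policy `jcut`): at every step `K` and source `t`,
`Σ_{u ∈ badClassK₁₃ … (cut jcut) K t} f u = Σ_{j < jcut K} Σ_{u ∈ stratum j} f u`, the stratum `j` being `badClassK₁₃ … (cut (j+1)) K t ∖ badClassK₁₃ … (cut j) K t` = the coarse class keys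
whose first large-field level is `j+1` — EXACT (CLAIM-1 §1 on the monotone chain `n ↦ badClassK₁₃ … (cut n) K t` from `∅`).
[cite: Balaban1989LargeFieldII, (1.80) p.384, (1.85) p.386; Balaban1988Convergent, (2.18) p.257 (bookkeeping)] -/
theorem sum_badClassK₁₃_cut_eq_sum_strata (jcut : ℕ → ℕ) (K : ℕ) (t : ℝ) (f : (Σ K, SiteSeqKey F (K₀ + K)) → ℝ) :
    ∑ u ∈ badClassK₁₃ θ K₀ g₀ kr (fun _ x => KeyOldLargeField (jcut x.1) x.2) K t, f u =
      ∑ j ∈ Finset.range (jcut K),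
        ∑ u ∈ badClassK₁₃ θ K₀ g₀ kr (fun _ x => KeyOldLargeField ((fun _ : ℕ => j + 1) x.1) x.2) K t \
            badClassK₁₃ θ K₀ g₀ kr (fun _ x => KeyOldLargeField ((fun _ : ℕ => j) x.1) x.2) K t, f u := by
  rw [badClassK₁₃_cut_congr_at θ K₀ g₀ kr hkr (jcut := jcut) (jcut' := fun _ => jcut K) (K := K) rfl t]
  exact sum_eq_sum_range_strata (S := fun n => badClassK₁₃ θ K₀ g₀ kr (fun _ x => KeyOldLargeField ((fun _ : ℕ => n) x.1) x.2) K t)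
    (badClassK₁₃_cut_zero_at θ K₀ g₀ kr hkr (jcut := fun _ => 0) rfl t)
    (fun _ _ h => badClassK₁₃_cut_mono_at θ K₀ g₀ kr hkr (jcut := fun _ => _) (jcut' := fun _ => _) h t) f (jcut K)

end Levels
/-! ## §3  The level sockets at a step-preserving dial: the canonical fraction is at most the sum of the per-birth-level fractions at the coarse carriers -/

section Sockets

variable (θ : Stage13HParams F N) (hP : θ.Provisos₁₃CoPH F N) (K₀ : ℕ) (g₀ : ℕ → ℝ) (os : List (ULoop F)) (krR : KeyReading₁₃ N K₀) (jcut : ℕ → ℕ)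
  (sh : ShellSplit₁₃CoPH N K₀) (hkr : ∀ (K : ℕ) (x : Σ K, SiteSeqKey F (K₀ + K)), x ∈ classSet₁₃ θ K₀ g₀ K → (krR F θ hP g₀ os K x).1 = K)
  [DecidableEq (Σ K, SiteSeqKey F (K₀ + K))]
include hkr

/-- **★★ THE DIAL READING's FRACTION IS AT MOST THE SUM OF THE PER-BIRTH-LEVEL FRACTIONS** (step-preserving dial, n20-d's level-cut bad reading): per-stratum relative bounds
`a j K ≥ 0` (run A) ∕ `b j K` (run B) at the COARSE carriers, `|t| ≤ 1`, `j < jcut K` ⇒ `(crOfRecord₁₃KAt K₀ kr (badKeyReadingOfCut₁₃ … jcut) sh …).W K ≤ Σ_{j<jcut K} max (a j K) (b j K)`.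
[cite: Balaban1989LargeFieldII, (1.80) p.384, (1.85)–(1.89) pp.386–387; King1986, (3.10)–(3.11) p.656 (bookkeeping)] -/
theorem W_crOfRecord₁₃KAt_le_sum_levels {a b : ℕ → ℕ → ℝ} (K : ℕ) (ha : ∀ j < jcut K, 0 ≤ a j K)
    (hA : ∀ t : ℝ, |t| ≤ 1 → ∀ j < jcut K,
      ∑ u ∈ badClassK₁₃ θ K₀ g₀ (krR F θ hP g₀ os) (fun _ x => KeyOldLargeField ((fun _ : ℕ => j + 1) x.1) x.2) K t \
          badClassK₁₃ θ K₀ g₀ (krR F θ hP g₀ os) (fun _ x => KeyOldLargeField ((fun _ : ℕ => j) x.1) x.2) K t, weightAK₁₃ θ hP K₀ g₀ os (krR F θ hP g₀ os) K t u ≤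
        a j K * ∑ u ∈ classSetK₁₃ θ K₀ g₀ (krR F θ hP g₀ os) K, weightAK₁₃ θ hP K₀ g₀ os (krR F θ hP g₀ os) K t u)
    (hB : ∀ t : ℝ, |t| ≤ 1 → ∀ j < jcut K,
      ∑ u ∈ badClassK₁₃ θ K₀ g₀ (krR F θ hP g₀ os) (fun _ x => KeyOldLargeField ((fun _ : ℕ => j + 1) x.1) x.2) K t \
          badClassK₁₃ θ K₀ g₀ (krR F θ hP g₀ os) (fun _ x => KeyOldLargeField ((fun _ : ℕ => j) x.1) x.2) K t, weightBK₁₃ θ hP K₀ g₀ os (krR F θ hP g₀ os) K t u ≤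
        b j K * ∑ u ∈ classSetK₁₃ θ K₀ g₀ (krR F θ hP g₀ os) K, weightBK₁₃ θ hP K₀ g₀ os (krR F θ hP g₀ os) K t u) :
    (crOfRecord₁₃KAt K₀ krR (badKeyReadingOfCut₁₃ N K₀ jcut) sh F θ hP g₀ os).W K ≤ ∑ j ∈ Finset.range (jcut K), max (a j K) (b j K) := by
  refine wInf_le_of_mem ⟨Finset.sum_nonneg fun j hj => (ha j (Finset.mem_range.1 hj)).trans (le_max_left _ _), fun t ht => ⟨?_, ?_⟩⟩
  · show ∑ u ∈ badClassK₁₃ θ K₀ g₀ (krR F θ hP g₀ os) (fun _ x => KeyOldLargeField (jcut x.1) x.2) K t, weightAK₁₃ θ hP K₀ g₀ os (krR F θ hP g₀ os) K t u ≤ _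
    rw [sum_badClassK₁₃_cut_eq_sum_strata θ K₀ g₀ (krR F θ hP g₀ os) hkr jcut K t, Finset.sum_mul]
    exact Finset.sum_le_sum fun j hj => (hA t ht j (Finset.mem_range.1 hj)).trans
      (mul_le_mul_of_nonneg_right (le_max_left _ _) (Finset.sum_nonneg fun u _ => weightAK₁₃_nonneg_of_provisos θ hP K₀ g₀ os (krR F θ hP g₀ os) K t u))
  · show ∑ u ∈ badClassK₁₃ θ K₀ g₀ (krR F θ hP g₀ os) (fun _ x => KeyOldLargeField (jcut x.1) x.2) K t, weightBK₁₃ θ hP K₀ g₀ os (krR F θ hP g₀ os) K t u ≤ _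
    rw [sum_badClassK₁₃_cut_eq_sum_strata θ K₀ g₀ (krR F θ hP g₀ os) hkr jcut K t, Finset.sum_mul]
    exact Finset.sum_le_sum fun j hj => (hB t ht j (Finset.mem_range.1 hj)).trans
      (mul_le_mul_of_nonneg_right (le_max_right _ _) (Finset.sum_nonneg fun u _ => weightBK₁₃_nonneg_of_provisos θ hP K₀ g₀ os (krR F θ hP g₀ os) K t u))

/-- **★★ N20 AT THE KEY-READING EDITION FROM PER-BIRTH-LEVEL BUDGETS** (step-preserving dial): per-stratum relative bounds at every step whose level sums are `< 1` and summable
⇒ `RelWeightBound` AT `crOfRecord₁₃KAt K₀ kr (badKeyReadingOfCut₁₃ … jcut) sh F θ hP g₀ os` with its canonical `W` (§1 ★★).  The per-stratum bounds are NE7b's body at the coarse key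
— NAMED OPEN. [cite: Balaban1989LargeFieldII, Thm 1 + (0.1) pp.355–356, (1.80) p.384; King1986, (3.10)–(3.11) p.656 (bookkeeping)] -/
theorem relWeightBound_crOfRecord₁₃KAt_of_levelFractions {a b : ℕ → ℕ → ℝ} (ha : ∀ K, ∀ j < jcut K, 0 ≤ a j K)
    (hA : ∀ (K : ℕ) (t : ℝ), |t| ≤ 1 → ∀ j < jcut K,
      ∑ u ∈ badClassK₁₃ θ K₀ g₀ (krR F θ hP g₀ os) (fun _ x => KeyOldLargeField ((fun _ : ℕ => j + 1) x.1) x.2) K t \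
          badClassK₁₃ θ K₀ g₀ (krR F θ hP g₀ os) (fun _ x => KeyOldLargeField ((fun _ : ℕ => j) x.1) x.2) K t, weightAK₁₃ θ hP K₀ g₀ os (krR F θ hP g₀ os) K t u ≤
        a j K * ∑ u ∈ classSetK₁₃ θ K₀ g₀ (krR F θ hP g₀ os) K, weightAK₁₃ θ hP K₀ g₀ os (krR F θ hP g₀ os) K t u)
    (hB : ∀ (K : ℕ) (t : ℝ), |t| ≤ 1 → ∀ j < jcut K,
      ∑ u ∈ badClassK₁₃ θ K₀ g₀ (krR F θ hP g₀ os) (fun _ x => KeyOldLargeField ((fun _ : ℕ => j + 1) x.1) x.2) K t \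
          badClassK₁₃ θ K₀ g₀ (krR F θ hP g₀ os) (fun _ x => KeyOldLargeField ((fun _ : ℕ => j) x.1) x.2) K t, weightBK₁₃ θ hP K₀ g₀ os (krR F θ hP g₀ os) K t u ≤
        b j K * ∑ u ∈ classSetK₁₃ θ K₀ g₀ (krR F θ hP g₀ os) K, weightBK₁₃ θ hP K₀ g₀ os (krR F θ hP g₀ os) K t u)
    (hlt : ∀ K, ∑ j ∈ Finset.range (jcut K), max (a j K) (b j K) < 1) (hsum : Summable fun K => ∑ j ∈ Finset.range (jcut K), max (a j K) (b j K)) :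
    RelWeightBound (crOfRecord₁₃KAt K₀ krR (badKeyReadingOfCut₁₃ N K₀ jcut) sh F θ hP g₀ os).l₀ (crOfRecord₁₃KAt K₀ krR (badKeyReadingOfCut₁₃ N K₀ jcut) sh F θ hP g₀ os).T
      (crOfRecord₁₃KAt K₀ krR (badKeyReadingOfCut₁₃ N K₀ jcut) sh F θ hP g₀ os).A (crOfRecord₁₃KAt K₀ krR (badKeyReadingOfCut₁₃ N K₀ jcut) sh F θ hP g₀ os).B
      (crOfRecord₁₃KAt K₀ krR (badKeyReadingOfCut₁₃ N K₀ jcut) sh F θ hP g₀ os).Bad (crOfRecord₁₃KAt K₀ krR (badKeyReadingOfCut₁₃ N K₀ jcut) sh F θ hP g₀ os).W := by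
  have hle : ∀ K, (crOfRecord₁₃KAt K₀ krR (badKeyReadingOfCut₁₃ N K₀ jcut) sh F θ hP g₀ os).W K ≤ ∑ j ∈ Finset.range (jcut K), max (a j K) (b j K) := fun K =>
    W_crOfRecord₁₃KAt_le_sum_levels θ hP K₀ g₀ os krR jcut sh hkr K (ha K) (hA K) (hB K)
  exact (relWeightBound_crOfRecord₁₃KAt_iff θ hP K₀ g₀ os krR (badKeyReadingOfCut₁₃ N K₀ jcut) sh).2
    ⟨fun K => (hle K).trans_lt (hlt K), Summable.of_nonneg_of_le (fun K => wInf_nonneg K) hle hsum⟩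

end Sockets
/-! ## §4  LOCATED — at the LEVEL-WINDOW dial the first level is NOT unbooked: the policy wall moves from «cut = 0» to «cut ≤ floor» -/

section Window

variable (θ : Stage13HParams F N) (K₀ : ℕ) (g₀ : ℕ → ℝ)

/-- The level window keeps the step component (so it is a step-preserving dial on every class set). [cite: Balaban1988Convergent, (2.18) p.257 (bookkeeping)] -/
theorem windowKeySigma_fst_eq (c : ℕ → ℕ) (K : ℕ) (x : Σ K, SiteSeqKey F (K₀ + K)) (hx : x ∈ classSet₁₃ θ K₀ g₀ K) : (windowKeySigma F c x).1 = K := by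
  rw [windowKeySigma_fst]
  exact fst_eq_of_mem_classSet₁₃ θ K₀ g₀ K hx

/-- **A CUT AT OR BELOW THE FLOOR AT STEP `K` BOOKS NOTHING AT STEP `K`** (the at-one-step form of n20-d's `bad_window_eq_empty_of_cut_le_floor`).
[cite: Balaban1989LargeFieldII, (1.80) p.384 (bookkeeping)] -/
theorem badClassK₁₃_window_cut_eq_empty_at {c jcut : ℕ → ℕ} {K : ℕ} (h : jcut K ≤ c K) (t : ℝ) :
    badClassK₁₃ θ K₀ g₀ (fun _ x => windowKeySigma F c x) (fun _ x => KeyOldLargeField (jcut x.1) x.2) K t = ∅ := by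
  refine Finset.eq_empty_of_forall_notMem fun u hu => ?_
  rw [mem_badClassK₁₃_cut_iff θ K₀ g₀ _ (fun K x hx => windowKeySigma_fst_eq θ K₀ g₀ c K x hx)] at hu
  letI : ∀ Kc, DecidableEq (SiteSeqKey F Kc) := fun _ => Classical.decEq _
  obtain ⟨hu, hbad⟩ := hu
  unfold classSetK₁₃ at hu
  obtain ⟨⟨K', y⟩, hx, rfl⟩ := Finset.mem_image.1 hu
  obtain rfl : K' = K := fst_eq_of_mem_classSet₁₃ θ K₀ g₀ K hx
  exact not_keyOldLargeField_windowKey h y hbad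

variable (hM : 0 < θ.τ9.M)
include hM

/-- **★ THE CUMULATIVE CHAIN AT THE KEY**: for a CLASS key of record `x` at step `K` and a level `1 ≤ n ≤ K₀ + K`, «an old large-field region at SOME level `≤ n`» ⟺ «the key's
small-field entry AT level `n` is not the whole lattice» — run A by gen 0's `keyOldLargeField_twoRunKeyA_iff_last` (the (2.1) chain `Λ_1 ⊇ Λ_2 ⊇ …` of an admissible index), run B one
level up through the exact block-down (`keyOldLargeField_twoRunKeyB_iff_last`, `blockDownSet_seq_Λ_succ_eq_univ_iff`).  Once born, a large-field region is visible at every later level.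
[cite: Balaban1988Convergent, (2.1) p.254, (2.18) p.257; Balaban1989LargeFieldII, (1.80) p.384 (bookkeeping)] -/
theorem keyOldLargeField_iff_last_of_mem_classSet₁₃ (K : ℕ) {x : Σ K, SiteSeqKey F (K₀ + K)} (hx : x ∈ classSet₁₃ θ K₀ g₀ K) {n : ℕ} (h1 : 1 ≤ n)
    (hn : n ≤ K₀ + K) : KeyOldLargeField n x.2 ↔ x.2.2 n ≠ Set.univ := by
  letI : ∀ Kc, DecidableEq (SiteSeqKey F Kc) := fun _ => Classical.decEq _
  unfold classSet₁₃ at hx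
  rcases Finset.mem_union.1 hx with h | h
  · obtain ⟨s, -, rfl⟩ := Finset.mem_image.1 h
    exact keyOldLargeField_twoRunKeyA_iff_last F θ.ν θ.τ9.M (histA₁₃ θ K₀ g₀ K) (K₀ + K) (K₀ + K) h1 hn s
  · obtain ⟨s', -, rfl⟩ := Finset.mem_image.1 h
    rw [keyB₁₃_eq θ K₀ g₀ hM K s']
    show KeyOldLargeField n (twoRunKeyB F θ.ν hM (histB₁₃ θ K₀ g₀ K) (K₀ + K) (K₀ + K) s') ↔
      (twoRunKeyB F θ.ν hM (histB₁₃ θ K₀ g₀ K) (K₀ + K) (K₀ + K) s').2 n ≠ Set.univ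
    rw [keyOldLargeField_twoRunKeyB_iff_last F θ.ν hM (histB₁₃ θ K₀ g₀ K) (K₀ + K) (K₀ + K) h1 hn s', twoRunKeyB_snd F θ.ν hM _ (K₀ + K) (K₀ + K) s' h1 hn,
      Ne, Ne, blockDownSet_seq_Λ_succ_eq_univ_iff F θ.ν θ.τ9.M (histB₁₃ θ K₀ g₀ K) s' hn]

/-- **★ A CLASS KEY WITH A LEVEL-1 LARGE FIELD READS TO A BAD WINDOW KEY UNDER EVERY CUT ABOVE THE FLOOR** (floor inside the run `c K < K₀ + K`, cut `c K < jcut K`): its entry at the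
first kept level `c K + 1` is not the whole lattice (cumulative chain), so `windowKeySigma F c x ∈ badClassK₁₃ … window (cut jcut) K t`.  The level window forgets the level-1 ENTRY, not
the level-1 REGION. [cite: Balaban1988Convergent, (2.1) p.254; Balaban1989LargeFieldII, (1.80) p.384 (bookkeeping)] -/
theorem windowKeySigma_mem_badClassK₁₃_of_levelOne {c jcut : ℕ → ℕ} (K : ℕ) (hcK : c K < K₀ + K) (hcut : c K < jcut K) (t : ℝ)
    {x : Σ K, SiteSeqKey F (K₀ + K)} (hx : x ∈ classSet₁₃ θ K₀ g₀ K) (h1 : KeyOldLargeField 1 x.2) :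
    windowKeySigma F c x ∈ badClassK₁₃ θ K₀ g₀ (fun _ y => windowKeySigma F c y) (fun _ y => KeyOldLargeField (jcut y.1) y.2) K t := by
  rw [mem_badClassK₁₃_iff]
  refine ⟨kr_mem_classSetK₁₃ θ K₀ g₀ (fun _ y => windowKeySigma F c y) hx, ?_⟩
  rcases x with ⟨K', y⟩
  obtain rfl : K' = K := fst_eq_of_mem_classSet₁₃ θ K₀ g₀ K hx
  show KeyOldLargeField (jcut K') (windowKey (c K') y)
  refine (keyOldLargeField_windowKey_iff (jcut K') (c K') y).2 ⟨c K' + 1, Nat.lt_succ_self _, hcut, ?_⟩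
  exact (keyOldLargeField_iff_last_of_mem_classSet₁₃ θ K₀ g₀ hM K' hx (Nat.succ_pos _) hcK).1 (h1.mono (Nat.succ_pos _))

variable (hP : θ.Provisos₁₃CoPH F N) (os : List (ULoop F))

/-- **THE LEVEL-ONE MASS IS BOOKED AT THE WINDOW KEY, run A**: at a step with floor inside the run and cut above the floor, `Σ_{badClass₁₃ … (fun _ ↦ 1) K t} weightA₁₃ ≤ Σ_{coarse bad
class at the window} weightAK₁₃` (n20-d's `sum_bad_weightAK₁₃_eq`: the coarse bad mass is the fine mass of the keys reading to bad window keys ⊇ the level-one class; weights `≥ 0`).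
[cite: Balaban1989LargeFieldII, (1.80) p.384; King1986, (3.10)–(3.11) p.656 (bookkeeping)] -/
theorem levelOne_mass_le_badMass_window_left {c jcut : ℕ → ℕ} (K : ℕ) (hcK : c K < K₀ + K) (hcut : c K < jcut K) (t : ℝ) :
    ∑ x ∈ badClass₁₃ θ K₀ g₀ (fun _ => 1) K t, weightA₁₃ θ hP K₀ g₀ os K t x ≤
      ∑ u ∈ badClassK₁₃ θ K₀ g₀ (fun _ y => windowKeySigma F c y) (fun _ y => KeyOldLargeField (jcut y.1) y.2) K t,
        weightAK₁₃ θ hP K₀ g₀ os (fun _ y => windowKeySigma F c y) K t u := by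
  letI : ∀ Kc, DecidableEq (SiteSeqKey F Kc) := fun _ => Classical.decEq _
  rw [sum_bad_weightAK₁₃_eq]
  refine Finset.sum_le_sum_of_subset_of_nonneg (fun x hx => ?_) fun x _ _ => weightA₁₃_nonneg F θ hP K₀ g₀ os K t x
  obtain ⟨hxT, h1⟩ := (mem_badKeysSigma_iff F _ _ x).1 hx
  have h1' : KeyOldLargeField 1 x.2 := fst_eq_of_mem_classSet₁₃ θ K₀ g₀ K hxT ▸ h1
  exact Finset.mem_filter.2 ⟨hxT, windowKeySigma_mem_badClassK₁₃_of_levelOne θ K₀ g₀ hM K hcK hcut t hxT h1'⟩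

/-- **… run B.** [cite: Balaban1989LargeFieldII, (1.80) p.384; King1986, (3.10)–(3.11) p.656 (bookkeeping)] -/
theorem levelOne_mass_le_badMass_window_right {c jcut : ℕ → ℕ} (K : ℕ) (hcK : c K < K₀ + K) (hcut : c K < jcut K) (t : ℝ) :
    ∑ x ∈ badClass₁₃ θ K₀ g₀ (fun _ => 1) K t, weightB₁₃ θ hP K₀ g₀ os K t x ≤
      ∑ u ∈ badClassK₁₃ θ K₀ g₀ (fun _ y => windowKeySigma F c y) (fun _ y => KeyOldLargeField (jcut y.1) y.2) K t,
        weightBK₁₃ θ hP K₀ g₀ os (fun _ y => windowKeySigma F c y) K t u := by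
  letI : ∀ Kc, DecidableEq (SiteSeqKey F Kc) := fun _ => Classical.decEq _
  rw [sum_bad_weightBK₁₃_eq]
  refine Finset.sum_le_sum_of_subset_of_nonneg (fun x hx => ?_) fun x _ _ => weightB₁₃_nonneg F θ hP K₀ g₀ os K t x
  obtain ⟨hxT, h1⟩ := (mem_badKeysSigma_iff F _ _ x).1 hx
  have h1' : KeyOldLargeField 1 x.2 := fst_eq_of_mem_classSet₁₃ θ K₀ g₀ K hxT ▸ h1
  exact Finset.mem_filter.2 ⟨hxT, windowKeySigma_mem_badClassK₁₃_of_levelOne θ K₀ g₀ hM K hcK hcut t hxT h1'⟩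

variable (c : FloorReading₁₃ N) (jc : (F : T4Family) → (θ : Stage13HParams F N) → θ.Provisos₁₃CoPH F N → (ℕ → ℝ) → List (ULoop F) → ℕ → ℕ) (sh : ShellSplit₁₃CoPH N K₀)

/-- **★★ FRACTION EXTRACTION AT THE WINDOW READING**: a `RelWeightBound … W` at the carriers of `crOfRecord₁₃KAt K₀ (windowKeyReading₁₃ K₀ c) (badKeyReadingOfCut₁₃ … (jc …)) sh` (floor
reading `c`, per-tuple cut `jc`), a step `K` with floor inside the run and cut above the floor, a source `|t| ≤ 1` with positive run-A mass of which the LEVEL-ONE class of record holds the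
fraction `κ` ⇒ `κ ≤ W K` (`T4BadClassBooking.le_weight_of_fraction_le` at the coarse carriers; the coarse total IS the fine total, `sum_weightAK₁₃_eq`).
[cite: Balaban1989LargeFieldII, (1.80) p.384; King1986, (3.10)–(3.11) p.656 (bookkeeping)] -/
theorem le_W_window_of_levelOne_fraction {W : ℕ → ℝ}
    (hW : RelWeightBound 1 (classSetK₁₃ θ K₀ g₀ (windowKeyReading₁₃ K₀ c F θ hP g₀ os)) (weightAK₁₃ θ hP K₀ g₀ os (windowKeyReading₁₃ K₀ c F θ hP g₀ os))
      (weightBK₁₃ θ hP K₀ g₀ os (windowKeyReading₁₃ K₀ c F θ hP g₀ os))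
      (badClassK₁₃ θ K₀ g₀ (windowKeyReading₁₃ K₀ c F θ hP g₀ os) (badKeyReadingOfCut₁₃ N K₀ (jc F θ hP g₀ os) F θ hP g₀ os)) W)
    {K : ℕ} (hcK : c F θ hP g₀ os K < K₀ + K) (hcut : c F θ hP g₀ os K < jc F θ hP g₀ os K) {t κ : ℝ} (ht : |t| ≤ 1)
    (hpos : 0 < ∑ x ∈ classSet₁₃ θ K₀ g₀ K, weightA₁₃ θ hP K₀ g₀ os K t x)
    (hκ : κ * ∑ x ∈ classSet₁₃ θ K₀ g₀ K, weightA₁₃ θ hP K₀ g₀ os K t x ≤ ∑ x ∈ badClass₁₃ θ K₀ g₀ (fun _ => 1) K t, weightA₁₃ θ hP K₀ g₀ os K t x) : κ ≤ W K := by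
  have htot := sum_weightAK₁₃_eq θ hP K₀ g₀ os (windowKeyReading₁₃ K₀ c F θ hP g₀ os) K t
  refine le_weight_of_fraction_le hW ht (by rw [htot]; exact hpos) ?_
  rw [htot]
  exact hκ.trans (levelOne_mass_le_badMass_window_left θ K₀ g₀ hM hP os K hcK hcut t)

/-- **★★ THE POLICY WALL AT THE LEVEL WINDOW.**  If from some step on the floor reading stays inside the run and the LEVEL-ONE class of record holds the fraction `κ > 0` of run A's mass at
some admissible source (the census's first-level saturation — DISPLAYED, dag-n20-w1 p597932's letter verbatim), then ANY `RelWeightBound` at the window reading with the level-cut bad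
reading forces the cut DOWN TO THE FLOOR for cofinitely many steps: `∀ᶠ K, jc … K ≤ c … K` (a step cutting above the floor in the saturated range pays `κ ≤ W K`, and `κ ≤ W K`
infinitely often contradicts `Summable W` — `T4ShellCount.not_summable_of_frequently_le`).  The wall of the full key («`∀ᶠ K, jc … K = 0`») is its floor-`0` instance.
[cite: Balaban1989LargeFieldII, Thm 1 + (0.1) pp.355–356, (1.80) p.384; Balaban1988Convergent, (2.1) p.254, p.244; King1986, (3.10)–(3.11) p.656 (bookkeeping)] -/
theorem eventually_cut_le_floor_of_relWeightBound_window {κ : ℝ} (hκ0 : 0 < κ) (hfloor : ∀ᶠ K in atTop, c F θ hP g₀ os K < K₀ + K)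
    (hsat : ∀ᶠ K in atTop, ∃ t : ℝ, |t| ≤ 1 ∧ 0 < ∑ x ∈ classSet₁₃ θ K₀ g₀ K, weightA₁₃ θ hP K₀ g₀ os K t x ∧
      κ * ∑ x ∈ classSet₁₃ θ K₀ g₀ K, weightA₁₃ θ hP K₀ g₀ os K t x ≤ ∑ x ∈ badClass₁₃ θ K₀ g₀ (fun _ => 1) K t, weightA₁₃ θ hP K₀ g₀ os K t x)
    {W : ℕ → ℝ}
    (hW : RelWeightBound 1 (classSetK₁₃ θ K₀ g₀ (windowKeyReading₁₃ K₀ c F θ hP g₀ os)) (weightAK₁₃ θ hP K₀ g₀ os (windowKeyReading₁₃ K₀ c F θ hP g₀ os))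
      (weightBK₁₃ θ hP K₀ g₀ os (windowKeyReading₁₃ K₀ c F θ hP g₀ os))
      (badClassK₁₃ θ K₀ g₀ (windowKeyReading₁₃ K₀ c F θ hP g₀ os) (badKeyReadingOfCut₁₃ N K₀ (jc F θ hP g₀ os) F θ hP g₀ os)) W) :
    ∀ᶠ K in atTop, jc F θ hP g₀ os K ≤ c F θ hP g₀ os K := by
  by_contra h
  have hfr : ∃ᶠ K in atTop, c F θ hP g₀ os K < jc F θ hP g₀ os K := (Filter.not_eventually.1 h).mono fun K hK => not_le.1 hK
  refine not_summable_of_frequently_le hκ0 (((hfloor.and hsat).and_frequently hfr).mono fun K hK => ?_) hW.summable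
  obtain ⟨⟨hcK, t, ht, hpos, hle⟩, hcut⟩ := hK
  exact le_W_window_of_levelOne_fraction θ K₀ g₀ hM hP os c jc hW hcK hcut ht hpos hle

/-- **★★ HENCE AT THE LEVEL WINDOW THE WEIGHT FACE BOOKS NOTHING, COFINITELY**: under the same displayed saturation, a `RelWeightBound` AT the window reading
`crOfRecord₁₃KAt K₀ (windowKeyReading₁₃ K₀ c) (badKeyReadingOfCut₁₃ … (jc …)) sh F θ hP g₀ os` (any witness, e.g. its canonical `W`) makes the coarse persistence class EMPTY for
cofinitely many steps — the level window does not give N20's weight face content; it moves the wall from «cut `= 0`» to «cut `≤` floor».  (A REGION-relative pending-status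
coarsening — the crux card's `wkey` — is a different, untyped quotient.) [cite: Balaban1989LargeFieldII, (1.80) p.384; Balaban1988Convergent, (2.1) p.254, p.244; King1986, (3.10)–(3.11) p.656 (bookkeeping)] -/
theorem eventually_badClassK₁₃_window_eq_empty_of_relWeightBound {κ : ℝ} (hκ0 : 0 < κ) (hfloor : ∀ᶠ K in atTop, c F θ hP g₀ os K < K₀ + K)
    (hsat : ∀ᶠ K in atTop, ∃ t : ℝ, |t| ≤ 1 ∧ 0 < ∑ x ∈ classSet₁₃ θ K₀ g₀ K, weightA₁₃ θ hP K₀ g₀ os K t x ∧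
      κ * ∑ x ∈ classSet₁₃ θ K₀ g₀ K, weightA₁₃ θ hP K₀ g₀ os K t x ≤ ∑ x ∈ badClass₁₃ θ K₀ g₀ (fun _ => 1) K t, weightA₁₃ θ hP K₀ g₀ os K t x)
    {W : ℕ → ℝ}
    (hW : RelWeightBound (crOfRecord₁₃KAt K₀ (windowKeyReading₁₃ K₀ c) (badKeyReadingOfCut₁₃ N K₀ (jc F θ hP g₀ os)) sh F θ hP g₀ os).l₀
      (crOfRecord₁₃KAt K₀ (windowKeyReading₁₃ K₀ c) (badKeyReadingOfCut₁₃ N K₀ (jc F θ hP g₀ os)) sh F θ hP g₀ os).T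
      (crOfRecord₁₃KAt K₀ (windowKeyReading₁₃ K₀ c) (badKeyReadingOfCut₁₃ N K₀ (jc F θ hP g₀ os)) sh F θ hP g₀ os).A
      (crOfRecord₁₃KAt K₀ (windowKeyReading₁₃ K₀ c) (badKeyReadingOfCut₁₃ N K₀ (jc F θ hP g₀ os)) sh F θ hP g₀ os).B
      (crOfRecord₁₃KAt K₀ (windowKeyReading₁₃ K₀ c) (badKeyReadingOfCut₁₃ N K₀ (jc F θ hP g₀ os)) sh F θ hP g₀ os).Bad W) :
    ∀ᶠ K in atTop, ∀ t : ℝ, (crOfRecord₁₃KAt K₀ (windowKeyReading₁₃ K₀ c) (badKeyReadingOfCut₁₃ N K₀ (jc F θ hP g₀ os)) sh F θ hP g₀ os).Bad K t = ∅ :=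
  (eventually_cut_le_floor_of_relWeightBound_window θ K₀ g₀ hM hP os c jc hκ0 hfloor hsat hW).mono fun _ hK t =>
    badClassK₁₃_window_cut_eq_empty_at θ K₀ g₀ hK t

end Window

end Summit.QuantumFields.YangMills.BalabanUVNodes.N20KeyedRelWeightAtKeyReading

end
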